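import Literature.MathematicalPhysics.QuantumFieldTheory.BalabanImbrieJaffe1984to88.BIJ88ElementaryRegions304

/-!
# `BalabanImbrieJaffe1984to88.BIJ88Clusters5134` — T. Bałaban, J. Imbrie, A. Jaffe, *Effective action and cluster properties of the abelian
Higgs model*, Commun. Math. Phys. **114** (1988) 257–315 [BalabanImbrieJaffe1988], §5.13 *Decoupling of the Small Field Region*, pp. 305–306
[PDF 49–50]: the COMBINATORIAL SKELETON of the decoupling expansion behind display (5.13.4) — the clusters of a set `Γ` of interpolated cubes,
the p. 305 fundamental-theorem-of-calculus expansion in its discrete (corner-sum / inclusion–exclusion) form, and the p. 306 factorization of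
every `Γ`-term over the clusters — PROVED for every cluster-factorizing family of "corner expectations". Companion file (same seat):
`BIJ88PolymerRep5134` (the regrouping into fillings `{X_α}` with the printed activities `g₁`, i.e. display (5.13.4), and the admissibility proviso).

statement-level skeleton of published theorems with citation tags; proofs where landed; nothing here is a claim about the Yang–Mills mass gap

PDF held: `paper:balaban1988-cmp114-bij-abelian-higgs-effective-action` (journal page = PDF page + 256); pp. 305–306 = PDF 49–50 rendered and read
as images this session (`renders/original-p049-x2.png`, `…p050-x2.png` of the p25 seat).

**The print (verbatim).** p. 305: *"we define a quadratic form for s = {s_i}_{i∈I}: Δ_s = Π_{i∈I}[(1−s_i)a_i + s_i]Δ = Σ_{Γ⊂I} Π_{i∈Γ}(1−s_i)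
Π_{i∈I∖Γ} s_i Δ_Γ … □_iΔ_s□_{i′} = s_is_{i′}□_iΔ□_{i′}, i′ ≠ i, □_iΔ_s□_i = □_iΔ□_i. … To give our expansion, we use the fundamental theorem of
calculus to write ⟨Π_{i∈I} f(□_i)⟩_1 = Σ_{Γ⊂I} ∫ds_Γ (∂/∂s_Γ)⟨Π_{i∈I} f(□_i)⟩_{s_Γ}. Here s_Γ specifies s_i = 0 for i ∉ Γ"*. p. 306: *"Let us
examine the factorization properties of this expansion. The form Δ has a range less than ½r(e_k). The f(□_i) do not couple different □_i. Hence
only adjacent □_i with s_i ≠ 0 interact in the above formula. Thus our expression for ∂/∂s_Γ⟨Π_{i∈I} f(□_i)⟩_{s_Γ} factorizes over the connected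
components of Γ. (Here we say that □_i is connected to □_{i′} if they abut on a hypersurface of any dimension.) The expression also factorizes
over the □_{i′}, i′ ∈ I∖Γ. Call the factorization regions clusters. … ⟨ ⟩_{s_Γ,X} is defined by integrating over the fields in X only."*

**The model (cube-index level, as in `BIJ88Resummation5141`/`BIJ88ElementaryRegions304` of this seat).** Cubes (elementary regions `□_i`) are
elements of a type `ι`, a region is a `Finset ι`, *"abut"* is an arbitrary decidable relation `adj` (used symmetrically). The expectations
enter only through their values at the parameter CORNERS `s = 1_Λ` (`s_i = 1` on `Λ`, `0` off `Λ`): `z X Λ` stands for `⟨Π_{i∈X} f(□_i)⟩_{1_Λ,X}`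
(fields in `X` only), over any commutative ring `R`. Justification: iterating `∫₀¹(d/ds_i)F ds_i = F|_{s_i=1} − F|_{s_i=0}` over `i ∈ Γ` evaluates
the printed term `∫ds_Γ ∂_Γ F|_{s=0 off Γ}` as the corner sum `Σ_{Λ⊆Γ}(−1)^{|Γ∖Λ|}F(1_Λ)` (`cornerSum`); conversely p02's
`BIJ88FTCExpansion305.ftc_expansion` applied on every sub-box plus Möbius inversion (`cornerSum_eq_of_forall_sum` below) identifies the two for
smooth `F`. The four properties of `z` the paper uses are bundled as `IsClusterFactorizing adj z` (a structure of `Prop`s, §3).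
* §1 CLUSTERS: `activePairs adj Λ` (the abutting pairs of active cubes — *"only adjacent □_i with s_i ≠ 0 interact"*), `cluster adj W Λ i` /
  `clusters adj W Λ` := the elementary regions of `BIJ88ElementaryRegions304` for that joining family (components of the active cubes, singletons
  `{i′}` for the inactive ones); `isSetPartition_clusters`, `mem_cluster_of_adj` (closure), `cluster_subset_of_closed` (minimality),
  **`cluster_of_not_mem`** (*"also factorizes over the □_{i′}, i′ ∈ I∖Γ"*: an inactive cube is its own cluster), `cluster_subset_active`,
  **`not_adj_of_cluster_ne`** (no active abutting pair joins two clusters), `clusters_inter`.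
* §2 CORNER SUMS: `cornerSum F Γ = Σ_{Λ⊆Γ}(−1)^{|Γ∖Λ|}F Λ`; **`sum_powerset_cornerSum`** (`F(W) = Σ_{Γ⊆W} cornerSum F Γ` — the p. 305 expansion
  in discrete form, an identity for every `F`); `cornerSum_eq_of_forall_sum` (Möbius inversion); **`cornerSum_union`** / **`cornerSum_partition`**
  (multiplicativity over decoupled groups of coordinates — the discrete `∂_{A∪B}(gh) = ∂_Ag·∂_Bh`, `∫ds_{A∪B} = ∫ds_A∫ds_B`).
* §3 CORNER DATA: `IsClusterFactorizing adj z` (empty region ↦ `1`; dependence on `Λ ∩ X` only; FACTORIZATION `z (X₁∪X₂) Λ = z X₁ Λ · z X₂ Λ`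
  across a cut met by no active abutting pair; `z {i} {i} = z {i} ∅` — `□_iΔ_s□_i = □_iΔ□_i`); `prod_partition`; **`corner_factorizes`**
  (`z W Λ = Π_{K∈clusters(W,Γ)} z K (Λ∩K)` for `Λ ⊆ Γ` — *"factorizes over the connected components of Γ … also over the □_{i′}"*).
* §4 THE EXPANSION OVER `Γ`: `act z K = cornerSum (z K) K` (`= ∫ds_K∂_K⟨Π_{i∈K}f(□_i)⟩_{s,K}`); **`IsClusterFactorizing.expansion`** /
  **`expansion'`**: `z W W = Σ_{Γ⊆W} [Π_{K∈clusters(W,Γ), K⊆Γ} act z K]·Π_{i∈W∖Γ} z {i} ∅`; `IsClusterFactorizing.act_singleton` (`act z {i} = 0`: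
  an isolated interpolated cube kills its term).

**Honest scope.** Finite identities about finite sets and sums in a commutative ring; the Gaussian model instance (that the expectations of
§5.13 satisfy `IsClusterFactorizing`, via `BIJ88ClusterFactorization306.expectation_factorizes` of p13) and the identification of `cornerSum` with
the printed `∫ds_Γ ∂/∂s_Γ` for the actual expectations are NOT in this file; (5.13.3) (the walk evaluation of the derivatives) is not modelled.
NOT summit progress; NOT continuum; NOT Clay. Imports: `BIJ88ElementaryRegions304` only; 0 `sorry`, 0 new `Prop` facts; modifies nothing.
Cell `lit-balaban` Phase 2, seat p25 gen 8; row C2.Eq5.13.3-5.13.4 (owner r16, referee ref-5).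
-/

open Finset
open Literature.Probability.LatticeModels (IsSetPartition setPartitions mem_setPartitions)
open Literature.MathematicalPhysics.QuantumFieldTheory.BalabanImbrieJaffe1984to88.BIJ88ElementaryRegions304
  (IsClosed region regions mem_region mem_region_self region_subset region_subset_of_isClosed isClosed_region
   region_eq_of_mem isSetPartition_regions mem_regions region_mem_regions)

namespace Literature.MathematicalPhysics.QuantumFieldTheory.BalabanImbrieJaffe1984to88.BIJ88Clusters5134

variable {ι : Type*} [DecidableEq ι]

/-! ## §1 Clusters of a set `Γ` of interpolated cubes: components under abutting, and the isolated cubes off `Γ` -/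

section Clusters

variable (adj : ι → ι → Prop) [DecidableRel adj]

/-- p. 306 [PDF 50], verbatim: *"Hence only adjacent □_i with s_i ≠ 0 interact in the above formula."* — the ACTIVE ADJACENT
PAIRS of a parameter corner `s = 1_Λ` (`s_i ≠ 0` exactly on `Λ`): the two-element sets `{j, j′}` of cubes of `Λ` with `j`
adjacent to `j′` (in either order; *"□_i is connected to □_{i′} if they abut on a hypersurface of any dimension"*). These are the
joining sets (in the sense of `BIJ88ElementaryRegions304`) generating the clusters. [cite: BalabanImbrieJaffe1988, p.306 (Sect. 5.13)] -/
def activePairs (Λ : Finset ι) : Finset (Finset ι) :=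
  ((Λ ×ˢ Λ).filter fun p => p.1 ≠ p.2 ∧ adj p.1 p.2).image fun p => {p.1, p.2}

/-- membership in `activePairs`. [cite: BalabanImbrieJaffe1988, p.306 (Sect. 5.13)] -/
theorem mem_activePairs {Λ : Finset ι} {Y : Finset ι} :
    Y ∈ activePairs adj Λ ↔ ∃ j ∈ Λ, ∃ j' ∈ Λ, j ≠ j' ∧ adj j j' ∧ Y = {j, j'} := by
  simp only [activePairs, mem_image, mem_filter, mem_product, Prod.exists]
  constructor
  · rintro ⟨a, b, ⟨⟨ha, hb⟩, hne, hab⟩, rfl⟩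
    exact ⟨a, ha, b, hb, hne, hab, rfl⟩
  · rintro ⟨a, ha, b, hb, hne, hab, rfl⟩
    exact ⟨a, b, ⟨⟨ha, hb⟩, hne, hab⟩, rfl⟩

/-- active pairs consist of cubes of `Λ`. [cite: BalabanImbrieJaffe1988, p.306 (Sect. 5.13)] -/
theorem subset_of_mem_activePairs {Λ Y : Finset ι} (hY : Y ∈ activePairs adj Λ) : Y ⊆ Λ := by
  obtain ⟨j, hj, j', hj', -, -, rfl⟩ := (mem_activePairs adj).1 hY
  intro x hx
  rcases mem_insert.1 hx with rfl | hx
  · exact hj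
  · rwa [mem_singleton.1 hx]

/-- `activePairs` is monotone in the active set. [cite: BalabanImbrieJaffe1988, p.306 (Sect. 5.13)] -/
theorem activePairs_mono {Λ Λ' : Finset ι} (h : Λ ⊆ Λ') : activePairs adj Λ ⊆ activePairs adj Λ' := by
  intro Y hY
  obtain ⟨j, hj, j', hj', hne, hadj, rfl⟩ := (mem_activePairs adj).1 hY
  exact (mem_activePairs adj).2 ⟨j, h hj, j', h hj', hne, hadj, rfl⟩

/-- **the cluster of a cube** (p. 306: *"Thus our expression … factorizes over the connected components of Γ. … The expression also
factorizes over the □_{i′}, i′ ∈ I∖Γ. Call the factorization regions clusters."*): for a region `W` (a set of cubes) and an active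
set `Λ`, the cluster of `i` is its class under the merging by active adjacent pairs — the connected component of `i` in
`(Λ ∩ W, abut)` when `i ∈ Λ`, the singleton `{i}` when `i ∉ Λ`. Implemented as the elementary region of
`BIJ88ElementaryRegions304` for the joining family `activePairs adj Λ`. [cite: BalabanImbrieJaffe1988, p.306 (Sect. 5.13)] -/
def cluster (W Λ : Finset ι) (i : ι) : Finset ι := region (activePairs adj Λ) W i

/-- **the clusters** of the active set `Λ` in the region `W` (p. 306 *"Call the factorization regions clusters"*): the family of the
clusters of the cubes of `W`. [cite: BalabanImbrieJaffe1988, p.306 (Sect. 5.13)] -/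
def clusters (W Λ : Finset ι) : Finset (Finset ι) := regions (activePairs adj Λ) W

/-- the clusters DECOMPOSE the region (a set partition of its cubes). [cite: BalabanImbrieJaffe1988, p.306 (Sect. 5.13)] -/
theorem isSetPartition_clusters (W Λ : Finset ι) : IsSetPartition W (clusters adj W Λ) :=
  isSetPartition_regions _ W

/-- membership in `clusters`. [cite: BalabanImbrieJaffe1988, p.306 (Sect. 5.13)] -/
theorem mem_clusters {W Λ K : Finset ι} : K ∈ clusters adj W Λ ↔ ∃ i ∈ W, cluster adj W Λ i = K := mem_regions

/-- a cube lies in its cluster. [cite: BalabanImbrieJaffe1988, p.306 (Sect. 5.13)] -/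
theorem mem_cluster_self {W Λ : Finset ι} {i : ι} (hi : i ∈ W) : i ∈ cluster adj W Λ i := mem_region_self hi

/-- a cluster lies in the region. [cite: BalabanImbrieJaffe1988, p.306 (Sect. 5.13)] -/
theorem cluster_subset (W Λ : Finset ι) (i : ι) : cluster adj W Λ i ⊆ W := region_subset _ W i

/-- the cluster of a cube of `W` is one of the clusters. [cite: BalabanImbrieJaffe1988, p.306 (Sect. 5.13)] -/
theorem cluster_mem_clusters {W Λ : Finset ι} {i : ι} (hi : i ∈ W) : cluster adj W Λ i ∈ clusters adj W Λ :=
  region_mem_regions hi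

/-- clusters are classes: a cube of the cluster of `i` has the same cluster. [cite: BalabanImbrieJaffe1988, p.306 (Sect. 5.13)] -/
theorem cluster_eq_of_mem {W Λ : Finset ι} {i j : ι} (hi : i ∈ W) (hj : j ∈ cluster adj W Λ i) :
    cluster adj W Λ j = cluster adj W Λ i := region_eq_of_mem hi hj

/-- **closure under active adjacency**: if `j` lies in the cluster of `i`, `j, j′ ∈ Λ`, `j′ ∈ W` and `j` abuts `j′`, then `j′` lies in
the same cluster (*"only adjacent □_i with s_i ≠ 0 interact"*). [cite: BalabanImbrieJaffe1988, p.306 (Sect. 5.13)] -/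
theorem mem_cluster_of_adj {W Λ : Finset ι} {i j j' : ι} (hj : j ∈ cluster adj W Λ i) (hjΛ : j ∈ Λ) (hj'Λ : j' ∈ Λ)
    (hj'W : j' ∈ W) (hne : j ≠ j') (h : adj j j' ∨ adj j' j) : j' ∈ cluster adj W Λ i := by
  have hc := isClosed_region (activePairs adj Λ) W i
  rcases h with h | h
  · have hY : ({j, j'} : Finset ι) ∈ activePairs adj Λ := (mem_activePairs adj).2 ⟨j, hjΛ, j', hj'Λ, hne, h, rfl⟩
    exact hc _ hY ⟨j, mem_inter.2 ⟨mem_insert_self _ _, hj⟩⟩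
      (mem_inter.2 ⟨mem_insert_of_mem (mem_singleton_self _), hj'W⟩)
  · have hY : ({j', j} : Finset ι) ∈ activePairs adj Λ := (mem_activePairs adj).2 ⟨j', hj'Λ, j, hjΛ, hne.symm, h, rfl⟩
    exact hc _ hY ⟨j, mem_inter.2 ⟨mem_insert_of_mem (mem_singleton_self _), hj⟩⟩
      (mem_inter.2 ⟨mem_insert_self _ _, hj'W⟩)

/-- a set of cubes containing `i` and closed under active adjacency contains the cluster of `i` (minimality).
[cite: BalabanImbrieJaffe1988, p.306 (Sect. 5.13)] -/
theorem cluster_subset_of_closed {W Λ T : Finset ι} {i : ι} (hT : T ⊆ W) (hiT : i ∈ T)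
    (hc : ∀ j ∈ T, ∀ j' ∈ W, j ∈ Λ → j' ∈ Λ → j ≠ j' → (adj j j' ∨ adj j' j) → j' ∈ T) :
    cluster adj W Λ i ⊆ T := by
  refine region_subset_of_isClosed hT hiT fun Y hY hne y hy => ?_
  obtain ⟨a, ha, b, hb, hab, hadj, rfl⟩ := (mem_activePairs adj).1 hY
  obtain ⟨k, hk⟩ := hne
  obtain ⟨hkY, hkT⟩ := mem_inter.1 hk
  obtain ⟨hyY, hyW⟩ := mem_inter.1 hy
  -- `k ∈ {a,b} ∩ T`, `y ∈ {a,b} ∩ W`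
  have hkab : k = a ∨ k = b := by simpa using hkY
  have hyab : y = a ∨ y = b := by simpa using hyY
  by_cases hyk : y = k
  · exact hyk ▸ hkT
  · rcases hkab with rfl | rfl <;> rcases hyab with rfl | rfl
    · exact absurd rfl hyk
    · exact hc k hkT y hyW ha hb hab (Or.inl hadj)
    · exact hc k hkT y hyW hb ha (Ne.symm hab) (Or.inr hadj)
    · exact absurd rfl hyk

/-- **an inactive cube is a cluster by itself** (*"also factorizes over the □_{i′}, i′ ∈ I∖Γ"*): for `i ∈ W ∖ Λ`, `cluster i = {i}`.
[cite: BalabanImbrieJaffe1988, p.306 (Sect. 5.13)] -/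
theorem cluster_of_not_mem {W Λ : Finset ι} {i : ι} (hi : i ∈ W) (hiΛ : i ∉ Λ) : cluster adj W Λ i = {i} := by
  refine Subset.antisymm ?_ (singleton_subset_iff.2 (mem_cluster_self adj hi))
  refine cluster_subset_of_closed adj (singleton_subset_iff.2 hi) (mem_singleton_self i) ?_
  intro j hj j' _ hjΛ _ _ _
  exact absurd (mem_singleton.1 hj ▸ hjΛ) hiΛ

/-- the cluster of an ACTIVE cube consists of active cubes: for `i ∈ Λ`, `cluster i ⊆ Λ`. [cite: BalabanImbrieJaffe1988, p.306 (Sect. 5.13)] -/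
theorem cluster_subset_active {W Λ : Finset ι} {i : ι} (hi : i ∈ W) (hiΛ : i ∈ Λ) : cluster adj W Λ i ⊆ Λ := by
  have h : cluster adj W Λ i ⊆ W ∩ Λ := by
    refine cluster_subset_of_closed adj inter_subset_left (mem_inter.2 ⟨hi, hiΛ⟩) ?_
    intro j _ j' hj'W _ hj'Λ _ _
    exact mem_inter.2 ⟨hj'W, hj'Λ⟩
  exact h.trans inter_subset_right

/-- a cluster with at least two cubes consists of active cubes. [cite: BalabanImbrieJaffe1988, p.306 (Sect. 5.13)] -/
theorem subset_active_of_two_le {W Λ K : Finset ι} (hK : K ∈ clusters adj W Λ) (h2 : 2 ≤ K.card) : K ⊆ Λ := by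
  obtain ⟨i, hi, rfl⟩ := (mem_clusters adj).1 hK
  by_cases hiΛ : i ∈ Λ
  · exact cluster_subset_active adj hi hiΛ
  · rw [cluster_of_not_mem adj hi hiΛ, card_singleton] at h2
    omega

/-- **no active pair joins two different clusters**: if `j`, `j′` are active cubes of `W` lying in different clusters, they do not
abut. [cite: BalabanImbrieJaffe1988, p.306 (Sect. 5.13)] -/
theorem not_adj_of_cluster_ne {W Λ : Finset ι} {j j' : ι} (hj : j ∈ W) (hj' : j' ∈ W) (hjΛ : j ∈ Λ) (hj'Λ : j' ∈ Λ)
    (hne : cluster adj W Λ j ≠ cluster adj W Λ j') : ¬ adj j j' := by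
  intro h
  by_cases hjj : j = j'
  · exact hne (hjj ▸ rfl)
  · have hmem : j' ∈ cluster adj W Λ j := mem_cluster_of_adj adj (mem_cluster_self adj hj) hjΛ hj'Λ hj' hjj (Or.inl h)
    exact hne (cluster_eq_of_mem adj hj hmem).symm

/-- the clusters depend on the active set only through its trace on the region. [cite: BalabanImbrieJaffe1988, p.306 (Sect. 5.13)] -/
theorem cluster_inter {W Λ : Finset ι} {i : ι} (hi : i ∈ W) : cluster adj W (Λ ∩ W) i = cluster adj W Λ i := by
  refine Subset.antisymm ?_ ?_
  · refine cluster_subset_of_closed adj (cluster_subset adj W Λ i) (mem_cluster_self adj hi) ?_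
    intro j hj j' hj'W hjΛ hj'Λ hne h
    exact mem_cluster_of_adj adj hj (mem_inter.1 hjΛ).1 (mem_inter.1 hj'Λ).1 hj'W hne h
  · refine cluster_subset_of_closed adj (cluster_subset adj W _ i) (mem_cluster_self adj hi) ?_
    intro j hj j' hj'W hjΛ hj'Λ hne h
    have hjW : j ∈ W := cluster_subset adj W _ i hj
    exact mem_cluster_of_adj adj hj (mem_inter.2 ⟨hjΛ, hjW⟩) (mem_inter.2 ⟨hj'Λ, hj'W⟩) hj'W hne h

/-- the clusters depend on the active set only through its trace on the region. [cite: BalabanImbrieJaffe1988, p.306 (Sect. 5.13)] -/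
theorem clusters_inter (W Λ : Finset ι) : clusters adj W (Λ ∩ W) = clusters adj W Λ :=
  image_congr fun _ hi => cluster_inter adj (mem_coe.1 hi)

end Clusters

/-! ## §2 The discrete form of the p. 305 FTC expansion: corner sums (inclusion–exclusion) -/

section Corner

variable {R : Type*} [CommRing R]

/-- p. 305 [PDF 49]: *"we use the fundamental theorem of calculus to write ⟨Π_{i∈I} f(□_i)⟩_1 = Σ_{Γ⊂I} ∫ds_Γ (∂/∂s_Γ)⟨Π f(□_i)⟩_{s_Γ}.
Here s_Γ specifies s_i = 0 for i ∉ Γ"* — the `Γ`-term EVALUATED: iterating the one-variable identity `∫₀¹ (d/ds_i)F ds_i =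
F|_{s_i=1} − F|_{s_i=0}` over `i ∈ Γ` gives the alternating CORNER SUM `Σ_{Λ⊆Γ} (−1)^{|Γ∖Λ|} F(1_Λ)` of the values of `F` at the
corners `s = 1_Λ` (`s_i = 1` on `Λ`, `0` elsewhere). Here `F Λ` stands for the corner value `F(1_Λ)`; the identification with the
printed iterated integral of the mixed derivative is `BIJ88FTCExpansion305.ftc_expansion` (p02) read backwards (Möbius inversion,
`cornerSum_eq_of_forall_sum`). [cite: BalabanImbrieJaffe1988, (5.13.3) p.305] -/
def cornerSum (F : Finset ι → R) (Γ : Finset ι) : R := ∑ Λ ∈ Γ.powerset, (-1 : R) ^ (Γ \ Λ).card * F Λ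

/-- the corner sum over no coordinate is the value itself. [cite: BalabanImbrieJaffe1988, (5.13.3) p.305] -/
@[simp] theorem cornerSum_empty (F : Finset ι → R) : cornerSum F ∅ = F ∅ := by
  simp [cornerSum]

/-- one coordinate: `∫₀¹ F′ = F(1) − F(0)`. [cite: BalabanImbrieJaffe1988, (5.13.3) p.305] -/
theorem cornerSum_singleton (F : Finset ι → R) (i : ι) : cornerSum F {i} = F {i} - F ∅ := by
  have hp : ({i} : Finset ι).powerset = {∅, {i}} := by
    ext S
    simp only [mem_powerset, subset_singleton_iff, mem_insert, mem_singleton]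
  rw [cornerSum, hp, sum_insert (by simp), sum_singleton]
  simp only [sdiff_empty, card_singleton, pow_one, sdiff_self, Finset.bot_eq_empty, card_empty, pow_zero, one_mul]
  ring

/-- `Σ_{S ⊆ X} (−1)^{|S|} = [X = ∅]` in any commutative ring. [cite: BalabanImbrieJaffe1988, (5.13.3) p.305] -/
theorem sum_powerset_neg_one_pow (X : Finset ι) : ∑ S ∈ X.powerset, (-1 : R) ^ S.card = if X = ∅ then 1 else 0 := by
  have h := Finset.sum_pow_mul_eq_add_pow (-1 : R) 1 X
  simp only [one_pow, mul_one, neg_add_cancel] at h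
  rw [h]
  by_cases hX : X = ∅
  · simp [hX]
  · simp [hX, card_eq_zero]

/-- the alternating sum over an interval `[Λ, W]` of the subset lattice: `Σ_{Λ⊆Γ⊆W} (−1)^{|Γ∖Λ|} = [Λ = W]`.
[cite: BalabanImbrieJaffe1988, (5.13.3) p.305] -/
theorem sum_interval_neg_one_pow {Λ W : Finset ι} (hΛ : Λ ⊆ W) :
    ∑ Γ ∈ W.powerset with Λ ⊆ Γ, (-1 : R) ^ (Γ \ Λ).card = if Λ = W then 1 else 0 := by
  have h : ∑ Γ ∈ W.powerset with Λ ⊆ Γ, (-1 : R) ^ (Γ \ Λ).card = ∑ S ∈ (W \ Λ).powerset, (-1 : R) ^ S.card := by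
    refine sum_nbij' (fun Γ => Γ \ Λ) (fun S => S ∪ Λ) ?_ ?_ ?_ ?_ ?_
    · intro Γ hΓ
      simp only [mem_filter, mem_powerset] at hΓ
      exact mem_powerset.2 (sdiff_subset_sdiff hΓ.1 le_rfl)
    · intro S hS
      simp only [mem_filter, mem_powerset] at hS ⊢
      exact ⟨union_subset (hS.trans sdiff_subset) hΛ, subset_union_right⟩
    · intro Γ hΓ
      simp only [mem_filter, mem_powerset] at hΓ
      exact sdiff_union_of_subset hΓ.2
    · intro S hS
      simp only [mem_powerset] at hS
      rw [union_sdiff_right, Finset.sdiff_eq_self_iff_disjoint]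
      exact disjoint_left.2 fun x hxS hxΛ => (mem_sdiff.1 (hS hxS)).2 hxΛ
    · intro Γ _
      rfl
  rw [h, sum_powerset_neg_one_pow]
  by_cases he : Λ = W
  · simp [he]
  · have hne : W \ Λ ≠ ∅ := by
      intro h0
      exact he (Subset.antisymm hΛ (sdiff_eq_empty_iff_subset.1 h0))
    simp [he, hne]

/-- **the discrete FTC expansion** (p. 305, `⟨Πf⟩_1 = Σ_{Γ⊂I} ∫ds_Γ ∂_Γ⟨Πf⟩_{s_Γ}` with each term evaluated as its corner sum):
`F(W) = Σ_{Γ⊆W} Σ_{Λ⊆Γ} (−1)^{|Γ∖Λ|} F(Λ)` — inclusion–exclusion on the subset lattice, valid for every `F`.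
[cite: BalabanImbrieJaffe1988, (5.13.3) p.305] -/
theorem sum_powerset_cornerSum (F : Finset ι → R) (W : Finset ι) : ∑ Γ ∈ W.powerset, cornerSum F Γ = F W := by
  simp only [cornerSum]
  rw [sum_comm' (t' := W.powerset) (s' := fun Λ => W.powerset.filter fun Γ => Λ ⊆ Γ)]
  · have h : ∀ Λ ∈ W.powerset, ∑ Γ ∈ W.powerset with Λ ⊆ Γ, (-1 : R) ^ (Γ \ Λ).card * F Λ = if Λ = W then F W else 0 := by
      intro Λ hΛ
      rw [← sum_mul, sum_interval_neg_one_pow (mem_powerset.1 hΛ)]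
      by_cases he : Λ = W
      · simp [he]
      · simp [he]
    rw [sum_congr rfl h, sum_ite_eq' W.powerset W (fun _ => F W), if_pos (mem_powerset.2 Subset.rfl)]
  · intro Γ Λ
    simp only [mem_powerset, mem_filter]
    constructor
    · rintro ⟨hΓW, hΛΓ⟩
      exact ⟨⟨hΓW, hΛΓ⟩, hΛΓ.trans hΓW⟩
    · rintro ⟨⟨hΓW, hΛΓ⟩, -⟩
      exact ⟨hΓW, hΛΓ⟩

/-- **Möbius inversion**: if `F(Γ) = Σ_{Γ′⊆Γ} J(Γ′)` for all `Γ ⊆ W`, then `J(Γ)` is the corner sum of `F` (`Γ ⊆ W`) — the form in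
which the printed terms `∫ds_Γ ∂_Γ F` are recovered from `ftc_expansion`. [cite: BalabanImbrieJaffe1988, (5.13.3) p.305] -/
theorem cornerSum_eq_of_forall_sum {F J : Finset ι → R} {W : Finset ι} (h : ∀ Γ ⊆ W, F Γ = ∑ Γ' ∈ Γ.powerset, J Γ') :
    ∀ Γ ⊆ W, cornerSum F Γ = J Γ := by
  intro Γ hΓ
  simp only [cornerSum]
  have h1 : ∀ Λ ∈ Γ.powerset, (-1 : R) ^ (Γ \ Λ).card * F Λ
      = ∑ Γ' ∈ Λ.powerset, (-1 : R) ^ (Γ \ Λ).card * J Γ' := by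
    intro Λ hΛ
    rw [h Λ ((mem_powerset.1 hΛ).trans hΓ), mul_sum]
  rw [sum_congr rfl h1,
    sum_comm' (t' := Γ.powerset) (s' := fun Γ' => Γ.powerset.filter fun Λ => Γ' ⊆ Λ)]
  · have h2 : ∀ Γ' ∈ Γ.powerset, ∑ Λ ∈ Γ.powerset with Γ' ⊆ Λ, (-1 : R) ^ (Γ \ Λ).card * J Γ'
        = if Γ' = Γ then J Γ else 0 := by
      intro Γ' hΓ'
      have hre : ∑ Λ ∈ Γ.powerset with Γ' ⊆ Λ, (-1 : R) ^ (Γ \ Λ).card * J Γ'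
          = (∑ Λ ∈ Γ.powerset with Γ' ⊆ Λ, (-1 : R) ^ (Λ \ Γ').card) * ((-1 : R) ^ (Γ \ Γ').card * J Γ') := by
        rw [sum_mul]
        refine sum_congr rfl fun Λ hΛ => ?_
        simp only [mem_filter, mem_powerset] at hΛ
        have hc : (Γ \ Γ').card = (Γ \ Λ).card + (Λ \ Γ').card := by
          rw [card_sdiff_of_subset hΛ.1, card_sdiff_of_subset hΛ.2, card_sdiff_of_subset (hΛ.2.trans hΛ.1)]
          have := card_le_card hΛ.1
          have := card_le_card hΛ.2
          omega
        rw [hc, pow_add]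
        have hsq : ((-1 : R) ^ (Λ \ Γ').card) * ((-1 : R) ^ (Λ \ Γ').card) = 1 := by
          rw [← pow_add, ← two_mul, pow_mul]
          simp
        linear_combination (-((-1 : R) ^ (Γ \ Λ).card * J Γ')) * hsq
      rw [hre, sum_interval_neg_one_pow (mem_powerset.1 hΓ')]
      by_cases he : Γ' = Γ
      · subst he
        simp
      · simp [he]
    rw [sum_congr rfl h2, sum_ite_eq' Γ.powerset Γ (fun _ => J Γ), if_pos (mem_powerset.2 Subset.rfl)]
  · intro Λ Γ'
    simp only [mem_powerset, mem_filter]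
    constructor
    · rintro ⟨h1, h2⟩
      exact ⟨⟨h1, h2⟩, h2.trans h1⟩
    · rintro ⟨⟨h1, h2⟩, -⟩
      exact ⟨h1, h2⟩

/-- summing over the subsets of a disjoint union = summing over pairs of subsets. [cite: BalabanImbrieJaffe1988, (5.13.3) p.305] -/
theorem sum_powerset_union {A B : Finset ι} (hAB : Disjoint A B) (f : Finset ι → R) :
    ∑ Λ ∈ (A ∪ B).powerset, f Λ = ∑ Λ₁ ∈ A.powerset, ∑ Λ₂ ∈ B.powerset, f (Λ₁ ∪ Λ₂) := by
  rw [← sum_product (s := A.powerset) (t := B.powerset) (f := fun p => f (p.1 ∪ p.2))]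
  refine sum_nbij' (fun Λ => (Λ ∩ A, Λ ∩ B)) (fun p => p.1 ∪ p.2) ?_ ?_ ?_ ?_ ?_
  · intro Λ _
    simp only [mem_product, mem_powerset]
    exact ⟨inter_subset_right, inter_subset_right⟩
  · intro p hp
    simp only [mem_product, mem_powerset] at hp ⊢
    exact union_subset_union hp.1 hp.2
  · intro Λ hΛ
    simp only [mem_powerset] at hΛ
    rw [← inter_union_distrib_left, inter_eq_left.2 hΛ]
  · intro p hp
    simp only [mem_product, mem_powerset] at hp
    have h1 : (p.1 ∪ p.2) ∩ A = p.1 := by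
      rw [union_inter_distrib_right, inter_eq_left.2 hp.1, disjoint_iff_inter_eq_empty.1 (hAB.symm.mono_left hp.2),
        union_empty]
    have h2 : (p.1 ∪ p.2) ∩ B = p.2 := by
      rw [union_inter_distrib_right, inter_eq_left.2 hp.2, disjoint_iff_inter_eq_empty.1 (hAB.mono_left hp.1),
        empty_union]
    exact Prod.ext h1 h2
  · intro Λ hΛ
    simp only [mem_powerset] at hΛ
    show f Λ = f (Λ ∩ A ∪ Λ ∩ B)
    rw [← inter_union_distrib_left, inter_eq_left.2 hΛ]

/-- **corner sums are multiplicative over decoupled coordinates**: if `F(Λ) = F_A(Λ∩A)·F_B(Λ∩B)` on the subsets of the disjoint union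
`A ∪ B`, then `Σ_{Λ⊆A∪B}(−1)^{|(A∪B)∖Λ|}F(Λ) = [Σ_{Λ₁⊆A}(−1)^{|A∖Λ₁|}F_A(Λ₁)]·[Σ_{Λ₂⊆B}(−1)^{|B∖Λ₂|}F_B(Λ₂)]` — the discrete
counterpart of `∂_{A∪B}(gh) = ∂_Ag·∂_Bh`, `∫ds_{A∪B} = ∫ds_A∫ds_B` for functions of disjoint sets of variables (p. 306: the expansion
*"factorizes"*). [cite: BalabanImbrieJaffe1988, p.306 (Sect. 5.13)] -/
theorem cornerSum_union {A B : Finset ι} (hAB : Disjoint A B) {F FA FB : Finset ι → R}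
    (h : ∀ Λ ⊆ A ∪ B, F Λ = FA (Λ ∩ A) * FB (Λ ∩ B)) : cornerSum F (A ∪ B) = cornerSum FA A * cornerSum FB B := by
  simp only [cornerSum]
  rw [sum_powerset_union hAB, sum_mul_sum]
  refine sum_congr rfl fun Λ₁ hΛ₁ => sum_congr rfl fun Λ₂ hΛ₂ => ?_
  simp only [mem_powerset] at hΛ₁ hΛ₂
  have h1 : (Λ₁ ∪ Λ₂) ∩ A = Λ₁ := by
    rw [union_inter_distrib_right, inter_eq_left.2 hΛ₁, disjoint_iff_inter_eq_empty.1 (hAB.symm.mono_left hΛ₂), union_empty]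
  have h2 : (Λ₁ ∪ Λ₂) ∩ B = Λ₂ := by
    rw [union_inter_distrib_right, inter_eq_left.2 hΛ₂, disjoint_iff_inter_eq_empty.1 (hAB.mono_left hΛ₁), empty_union]
  have hsd : (A ∪ B) \ (Λ₁ ∪ Λ₂) = (A \ Λ₁) ∪ (B \ Λ₂) := by
    ext x
    simp only [mem_sdiff, mem_union, not_or]
    constructor
    · rintro ⟨hx | hx, h1', h2'⟩
      · exact Or.inl ⟨hx, h1'⟩
      · exact Or.inr ⟨hx, h2'⟩
    · rintro (⟨hx, h1'⟩ | ⟨hx, h2'⟩)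
      · exact ⟨Or.inl hx, h1', fun h => disjoint_left.1 hAB hx (hΛ₂ h)⟩
      · exact ⟨Or.inr hx, fun h => disjoint_left.1 hAB (hΛ₁ h) hx, h2'⟩
  have hdis : Disjoint (A \ Λ₁) (B \ Λ₂) := hAB.mono sdiff_subset sdiff_subset
  rw [h _ (union_subset_union hΛ₁ hΛ₂), h1, h2, hsd, card_union_of_disjoint hdis, pow_add]
  ring

/-- **corner sums factorize over a decoupled decomposition**: if `P` partitions `W`, `Γ ⊆ W`, and `F(Λ) = Π_{K∈P} G_K(Λ∩K)` for `Λ ⊆ Γ`,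
then `Σ_{Λ⊆Γ}(−1)^{|Γ∖Λ|}F(Λ) = Π_{K∈P} Σ_{Λ⊆Γ∩K}(−1)^{|(Γ∩K)∖Λ|}G_K(Λ)` (p. 306: *"our expression for ∂/∂s_Γ⟨Πf(□_i)⟩_{s_Γ}
factorizes"*). [cite: BalabanImbrieJaffe1988, p.306 (Sect. 5.13)] -/
theorem cornerSum_partition {P : Finset (Finset ι)} :
    ∀ {W Γ : Finset ι}, IsSetPartition W P → Γ ⊆ W → ∀ (G : Finset ι → Finset ι → R) {F : Finset ι → R},
      (∀ Λ ⊆ Γ, F Λ = ∏ K ∈ P, G K (Λ ∩ K)) → cornerSum F Γ = ∏ K ∈ P, cornerSum (G K) (Γ ∩ K) := by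
  induction P using Finset.induction_on with
  | empty =>
      intro W Γ hP hΓ G F h
      have hW : W = ∅ := eq_empty_of_forall_notMem fun v hv => by
        obtain ⟨K, hK, -⟩ := hP.exists_mem hv
        exact (notMem_empty K) hK
      have hΓ0 : Γ = ∅ := subset_empty.1 (hW ▸ hΓ)
      subst hΓ0
      rw [cornerSum_empty, prod_empty, h ∅ Subset.rfl, prod_empty]
  | insert K₀ P hK₀ ih =>
      intro W Γ hP hΓ G F h
      have hP' : IsSetPartition (W \ K₀) P := by
        have h1 := hP.erase (mem_insert_self K₀ P)
        rwa [erase_insert hK₀] at h1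
      have hsplit : Γ ∩ K₀ ∪ Γ \ K₀ = Γ := by
        rw [union_comm, sdiff_union_inter]
      have hdis : Disjoint (Γ ∩ K₀) (Γ \ K₀) := disjoint_sdiff.mono_left inter_subset_right
      have hKdis : ∀ K ∈ P, Disjoint K K₀ := fun K hK =>
        disjoint_left.2 fun x hxK hxK₀ => (mem_sdiff.1 (hP'.subset hK hxK)).2 hxK₀
      rw [prod_insert hK₀, ← hsplit,
        cornerSum_union hdis (FA := G K₀) (FB := fun Λ => ∏ K ∈ P, G K (Λ ∩ K)) ?_, hsplit]
      · congr 1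
        rw [ih hP' (sdiff_subset_sdiff hΓ Subset.rfl) G (F := fun Λ => ∏ K ∈ P, G K (Λ ∩ K)) (fun Λ _ => rfl)]
        refine prod_congr rfl fun K hK => ?_
        congr 1
        ext x
        simp only [mem_inter, mem_sdiff]
        constructor
        · rintro ⟨⟨hxΓ, -⟩, hxK⟩
          exact ⟨hxΓ, hxK⟩
        · rintro ⟨hxΓ, hxK⟩
          exact ⟨⟨hxΓ, fun hxK₀ => disjoint_left.1 (hKdis K hK) hxK hxK₀⟩, hxK⟩
      · intro Λ hΛ
        rw [hsplit] at hΛ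
        rw [h Λ hΛ, prod_insert hK₀]
        congr 1
        · congr 1
          rw [← inter_assoc, inter_eq_left.2 hΛ]
        · refine prod_congr rfl fun K hK => ?_
          congr 1
          ext x
          simp only [mem_inter, mem_sdiff]
          constructor
          · rintro ⟨hxΛ, hxK⟩
            exact ⟨⟨hxΛ, hΛ hxΛ, fun hxK₀ => disjoint_left.1 (hKdis K hK) hxK hxK₀⟩, hxK⟩
          · rintro ⟨⟨hxΛ, -, -⟩, hxK⟩
            exact ⟨hxΛ, hxK⟩

end Corner

/-! ## §3 Cluster-factorizing corner data: the expectations `⟨Π_{i∈X} f(□_i)⟩_{1_Λ, X}` abstracted -/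

section CornerData

variable (adj : ι → ι → Prop) [DecidableRel adj] {R : Type*} [CommRing R]

/-- **corner data**: `z X Λ` models the expectation `⟨Π_{i∈X} f(□_i)⟩_{s,X}` over the fields in the region `X` only (p. 306: *"⟨ ⟩_{s_Γ,X}
is defined by integrating over the fields in X only"*) at the parameter corner `s = 1_Λ`, and the four properties the paper uses of it:
no region — expectation `1`; dependence on the active cubes OF `X` only; **factorization** when no active adjacent pair joins two parts
(p. 306: *"The f(□_i) do not couple different □_i. Hence only adjacent □_i with s_i ≠ 0 interact … factorizes"*); and a single cube carries
no interpolation (`□_iΔ_s□_i = □_iΔ□_i`, p. 305). A structure of `Prop`s about the data `z`; its Gaussian instance is a separate file.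
[cite: BalabanImbrieJaffe1988, p.306 (Sect. 5.13)] -/
structure IsClusterFactorizing (z : Finset ι → Finset ι → R) : Prop where
  /-- no cubes, no fields: the empty expectation is `1`. -/
  empty : ∀ Λ, z ∅ Λ = 1
  /-- only the active cubes of the region matter. -/
  local_inter : ∀ X Λ, z X Λ = z X (Λ ∩ X)
  /-- factorization across a cut met by no active adjacent pair. -/
  split : ∀ X₁ X₂ Λ, Disjoint X₁ X₂ →
    (∀ j ∈ X₁, ∀ j' ∈ X₂, j ∈ Λ → j' ∈ Λ → ¬ adj j j' ∧ ¬ adj j' j) → z (X₁ ∪ X₂) Λ = z X₁ Λ * z X₂ Λ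
  /-- `□_iΔ_s□_i = □_iΔ□_i`: one cube alone does not see its own parameter. -/
  single : ∀ i, z {i} {i} = z {i} ∅

variable {adj}

omit [DecidableRel adj] in
/-- **factorization over any decomposition met by no active adjacent pair** (p. 306 *"factorizes"*, iterated): if `P` partitions `X` and no
active adjacent pair joins two different blocks, `z X Λ = Π_{K∈P} z K Λ`. [cite: BalabanImbrieJaffe1988, p.306 (Sect. 5.13)] -/
theorem IsClusterFactorizing.prod_partition {z : Finset ι → Finset ι → R} (hz : IsClusterFactorizing adj z) {Λ : Finset ι} :
    ∀ (P : Finset (Finset ι)) (X : Finset ι), IsSetPartition X P →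
      (∀ K ∈ P, ∀ K' ∈ P, K ≠ K' → ∀ j ∈ K, ∀ j' ∈ K', j ∈ Λ → j' ∈ Λ → ¬ adj j j') →
      z X Λ = ∏ K ∈ P, z K Λ := by
  intro P
  induction P using Finset.induction_on with
  | empty =>
      intro X hX _
      have hX0 : X = ∅ := eq_empty_of_forall_notMem fun v hv => by
        obtain ⟨K, hK, -⟩ := hX.exists_mem hv
        exact (notMem_empty K) hK
      rw [hX0, prod_empty, hz.empty]
  | insert K₀ P hK₀ ih =>
      intro X hX hcross
      have hK₀X : K₀ ⊆ X := hX.subset (mem_insert_self _ _)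
      have hP : IsSetPartition (X \ K₀) P := by
        have h := hX.erase (mem_insert_self K₀ P)
        rwa [erase_insert hK₀] at h
      have hXeq : X = K₀ ∪ (X \ K₀) := (union_sdiff_of_subset hK₀X).symm
      rw [prod_insert hK₀, hXeq, hz.split K₀ (X \ K₀) Λ disjoint_sdiff ?_]
      · rw [ih (X \ K₀) hP fun K hK K' hK' hne => hcross K (mem_insert_of_mem hK) K' (mem_insert_of_mem hK') hne]
      · intro j hj j' hj' hjΛ hj'Λ
        obtain ⟨K', hK', hj'K'⟩ := hP.exists_mem hj'
        have hne : K₀ ≠ K' := fun h => hK₀ (h ▸ hK')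
        exact ⟨hcross K₀ (mem_insert_self _ _) K' (mem_insert_of_mem hK') hne j hj j' hj'K' hjΛ hj'Λ,
          hcross K' (mem_insert_of_mem hK') K₀ (mem_insert_self _ _) hne.symm j' hj'K' j hj hj'Λ hjΛ⟩

/-- **the corner values factorize over the clusters** (p. 306: *"factorizes over the connected components of Γ … also over the □_{i′},
i′ ∈ I∖Γ"*): for `Λ ⊆ Γ`, `z W Λ = Π_{K ∈ clusters(W,Γ)} z K (Λ ∩ K)`. [cite: BalabanImbrieJaffe1988, p.306 (Sect. 5.13)] -/
theorem IsClusterFactorizing.corner_factorizes {z : Finset ι → Finset ι → R} (hz : IsClusterFactorizing adj z) {W Γ Λ : Finset ι}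
    (hΛ : Λ ⊆ Γ) : z W Λ = ∏ K ∈ clusters adj W Γ, z K (Λ ∩ K) := by
  rw [hz.prod_partition (clusters adj W Γ) W (isSetPartition_clusters adj W Γ)]
  · exact prod_congr rfl fun K _ => hz.local_inter K Λ
  · intro K hK K' hK' hne j hj j' hj' hjΛ hj'Λ
    obtain ⟨i, hi, rfl⟩ := (mem_clusters adj).1 hK
    obtain ⟨i', hi', rfl⟩ := (mem_clusters adj).1 hK'
    have hjW : j ∈ W := cluster_subset adj W Γ i hj
    have hj'W : j' ∈ W := cluster_subset adj W Γ i' hj'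
    refine not_adj_of_cluster_ne adj hjW hj'W (hΛ hjΛ) (hΛ hj'Λ) ?_
    rwa [cluster_eq_of_mem adj hi hj, cluster_eq_of_mem adj hi' hj']

end CornerData

/-! ## §4 The expansion over `Γ ⊂ I` with its terms factorized; the activities -/

section Expansion

variable (adj : ι → ι → Prop) [DecidableRel adj] {R : Type*} [CommRing R]

/-- the "derivative" activity of a region `K`: `a(K) = ∫ds_K ∂_K ⟨Π_{i∈K} f(□_i)⟩_{s,K}` in corner form, `Σ_{Λ⊆K} (−1)^{|K∖Λ|} z K Λ` (the
term of p. 306's `g₁(K)` with `Γ = K`). [cite: BalabanImbrieJaffe1988, p.306 (Sect. 5.13)] -/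
def act (z : Finset ι → Finset ι → R) (K : Finset ι) : R := cornerSum (z K) K

/-- a one-cube region has derivative activity `z {i} {i} − z {i} ∅`. [cite: BalabanImbrieJaffe1988, p.306 (Sect. 5.13)] -/
theorem act_singleton (z : Finset ι → Finset ι → R) (i : ι) : act z {i} = z {i} {i} - z {i} ∅ := cornerSum_singleton _ i

variable {adj}

omit [DecidableRel adj] in
/-- … which VANISHES for cluster-factorizing data (`□_iΔ_s□_i = □_iΔ□_i`: `⟨f(□_i)⟩_{s_i,{i}}` does not depend on `s_i`).
[cite: BalabanImbrieJaffe1988, p.305 (Sect. 5.13)] -/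
theorem IsClusterFactorizing.act_singleton {z : Finset ι → Finset ι → R} (hz : IsClusterFactorizing adj z) (i : ι) : act z {i} = 0 := by
  rw [_root_.Literature.MathematicalPhysics.QuantumFieldTheory.BalabanImbrieJaffe1984to88.BIJ88Clusters5134.act_singleton, hz.single,
    sub_self]

/-- a cluster either consists of active (interpolated) cubes or is a single inactive cube. [cite: BalabanImbrieJaffe1988, p.306 (Sect. 5.13)] -/
theorem subset_or_singleton_of_mem_clusters {W Γ K : Finset ι} (hK : K ∈ clusters adj W Γ) :
    K ⊆ Γ ∨ ∃ i ∈ W \ Γ, K = {i} := by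
  obtain ⟨i, hi, rfl⟩ := (mem_clusters adj).1 hK
  by_cases hiΓ : i ∈ Γ
  · exact Or.inl (cluster_subset_active adj hi hiΓ)
  · exact Or.inr ⟨i, mem_sdiff.2 ⟨hi, hiΓ⟩, cluster_of_not_mem adj hi hiΓ⟩

/-- the clusters not consisting of interpolated cubes are exactly the singletons of the inactive cubes.
[cite: BalabanImbrieJaffe1988, p.306 (Sect. 5.13)] -/
theorem clusters_filter_not_subset (W Γ : Finset ι) :
    (clusters adj W Γ).filter (fun K => ¬ K ⊆ Γ) = (W \ Γ).image fun i => ({i} : Finset ι) := by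
  ext K
  simp only [mem_filter, mem_image]
  constructor
  · rintro ⟨hK, hKΓ⟩
    rcases subset_or_singleton_of_mem_clusters (adj := adj) hK with h | ⟨i, hi, rfl⟩
    · exact absurd h hKΓ
    · exact ⟨i, hi, rfl⟩
  · rintro ⟨i, hi, rfl⟩
    obtain ⟨hiW, hiΓ⟩ := mem_sdiff.1 hi
    refine ⟨?_, fun h => hiΓ (h (mem_singleton_self i))⟩
    rw [← cluster_of_not_mem adj hiW hiΓ]
    exact cluster_mem_clusters adj hiW

/-- **THE EXPANSION OVER `Γ ⊂ I`, FACTORIZED** (p. 305 FTC expansion + p. 306 factorization over the clusters): for cluster-factorizing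
corner data, `z W W = Σ_{Γ⊆W} Π_{K ∈ clusters(W,Γ)} Σ_{Λ⊆Γ∩K} (−1)^{|(Γ∩K)∖Λ|} z K Λ` — i.e. `⟨Π_{i∈I}f(□_i)⟩_1 = Σ_Γ Π_{clusters K}
∫ds_{Γ∩K} ∂_{Γ∩K} ⟨Π_{i∈K} f(□_i)⟩_{s,K}` in corner form. [cite: BalabanImbrieJaffe1988, (5.13.3) p.305–306] -/
theorem IsClusterFactorizing.expansion {z : Finset ι → Finset ι → R} (hz : IsClusterFactorizing adj z) (W : Finset ι) :
    z W W = ∑ Γ ∈ W.powerset, ∏ K ∈ clusters adj W Γ, cornerSum (z K) (Γ ∩ K) := by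
  rw [← sum_powerset_cornerSum (z W) W]
  refine sum_congr rfl fun Γ hΓ => ?_
  exact cornerSum_partition (isSetPartition_clusters adj W Γ) (mem_powerset.1 hΓ) z fun Λ hΛ => hz.corner_factorizes hΛ

/-- the same with the two kinds of clusters separated: the components `K ⊆ Γ` carry their derivative activity `a(K)`, the inactive cubes
`i ∈ W ∖ Γ` carry `⟨f(□_i)⟩ = z {i} ∅`: `z W W = Σ_{Γ⊆W} [Π_{K ∈ clusters(W,Γ), K⊆Γ} a(K)]·Π_{i∈W∖Γ} z {i} ∅`.
[cite: BalabanImbrieJaffe1988, (5.13.3) p.305–306] -/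
theorem IsClusterFactorizing.expansion' {z : Finset ι → Finset ι → R} (hz : IsClusterFactorizing adj z) (W : Finset ι) :
    z W W = ∑ Γ ∈ W.powerset, (∏ K ∈ (clusters adj W Γ).filter (· ⊆ Γ), act z K) * ∏ i ∈ W \ Γ, z {i} ∅ := by
  rw [hz.expansion W]
  refine sum_congr rfl fun Γ _ => ?_
  rw [← prod_filter_mul_prod_filter_not (clusters adj W Γ) (· ⊆ Γ)]
  congr 1
  · refine prod_congr rfl fun K hK => ?_
    rw [(mem_filter.1 hK).2 |> inter_eq_right.2, act]
  · -- the clusters not inside `Γ` are the singletons `{i}`, `i ∈ W ∖ Γ`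
    rw [clusters_filter_not_subset (adj := adj) W Γ, prod_image fun i _ j _ h => singleton_injective h]
    refine prod_congr rfl fun i hi => ?_
    rw [inter_singleton_of_notMem (mem_sdiff.1 hi).2, cornerSum_empty]

end Expansion

end Literature.MathematicalPhysics.QuantumFieldTheory.BalabanImbrieJaffe1984to88.BIJ88Clusters5134
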